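import Mathlib
import HarnessLib
import Summits.KontsevichZagierPeriods.Zeta5Search.Denom.DigitBridge
import Summits.KontsevichZagierPeriods.Zeta5Search.TwoTaleP15Residue

/-!
# DigitCover — a level interval of the saving product covered by a CHAIN OF CHECKED DIGIT CELLS (generic in the rung)

HONEST FRAMING: systematic search; no irrationality claim unless certified.

OUR theorem (Summit side), fam-denom (pub-zeta5); `p`-adic bookkeeping only, nothing here bears on irrationality.
Along a two-tale cone point with level-`n` parameters `a = aOne α n`, `b = bOne β n` (first tale) and partner
`â = aTwo A n`, `b̂ = bTwo B n` (second tale), the saving product counts a prime `p` once for every LEVEL INTERVAL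
`[U₁/U₂, V₁/V₂)` of the digit function containing `{n/p}`; the arithmetic input "`p^lvl ∣ q(a,b)` and
`p^lvl ∣ D_{M₁}D_{M₂} p(a,b)` for every counted prime of a level-`lvl` interval" is proved here ONCE, from a table:

* a `CCell` is a row of a digit table — an open `x`-cell `(a₀/b₀, a₁/b₁)` with a certified count `c` and its strip
  lines (`Denom.DigitCert.Cell`) — tagged with the tale that certifies it: `perm = some v` = Zudilin's Lemma 7 with the
  index permutation `v` (`σa = a ∘ v`), `perm = none` = Lemma 8 at the partner;
* a `Cover` of `[U₁/U₂, V₁/V₂)` at level `lvl` is a list of such cells; **`Cover.check`** (a `Bool`, run by `decide`)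
  verifies `c ≥ lvl`, denominators `≤ D`, `v` a permutation, the cell checker `Cell.check` against the right term list
  (`DigitBridge.terms7` / `terms8`), and that the cells CHAIN from `U₁/U₂` to at least `V₁/V₂` (`chainOK`);
* **soundness** `dvd_of_cover`: for a prime `p > D` (so `{n/p} = r/p` is never a cell end point, `div_ne_of_prime`)
  with `β₃ n < p²` and `{n/p} ∈ [U₁/U₂, V₁/V₂)`, some cell of the chain contains `{n/p}` (`exists_mem_of_chainOK`) and
  the DIGIT BRIDGE (`DigitBridge.pow_dvd_formQZ_of_cell` / `pow_dvd_formPZ_of_cell`, resp.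
  `padicNorm_formQT_le_of_cell` / `padicNorm_formPT_le_of_cell` combined with the two-tale coincidence
  `q = −q̂`, `p = −p̂` — an INPUT wherever a second-tale cell is used — and `p ∣ D_{M₁}, D_{M₂}`) gives
  `p^lvl ∣ formQZ a b` and `p^lvl ∣ formPZ a b M₁ M₂`; `dvd_of_cover₁` is the unconditional first-tale-only case.
The rung D1 = L(1/3) instantiates this in `Denom.TwoTaleD1DigitTables` (32 covers, 106 cells); every later rung of
the Ω-ladder is another table.  0 sorry.
References: W. Zudilin, arXiv:1310.1526 [Zudilin2014ZetaTwo], Lemmas 7–8.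
-/

namespace Summit.KontsevichZagierPeriods.Zeta5Search

namespace Denom.DigitCover

open DigitCert DigitBridge
open Literature.NumberTheory.Irrationality.Zudilin2014
open Literature.NumberTheory.Transcendental (OddZeta.dvd_lcmUpto)

/-! ### Cover tables and their checker -/

/-- A row of a digit table tagged with its tale: `perm = some v` — first tale, Lemma 7 with the index permutation
`v` (`σa = a ∘ v`); `perm = none` — second tale, Lemma 8 at the partner. -/
structure CCell where
  /-- `some v`: first tale with permutation `v`; `none`: second tale -/
  perm : Option (Fin 4 → Fin 4)
  /-- the open `x`-cell `(a₀/b₀, a₁/b₁)`, its certified count `c` and its strip lines -/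
  cell : Cell

/-- A cover of the level interval `[U₁/U₂, V₁/V₂)` at level `lvl` by a chain of tagged cells. -/
structure Cover where
  /-- the level: the exponent of `p` to be certified -/
  lvl : ℕ
  /-- numerator of the left end point -/
  U₁ : ℕ
  /-- denominator of the left end point -/
  U₂ : ℕ
  /-- numerator of the right end point -/
  V₁ : ℕ
  /-- denominator of the right end point -/
  V₂ : ℕ
  /-- the chain of cells, left to right -/
  cells : List CCell

/-- The first tale's term list with the permutation given as a plain map `v` (`= terms7 α β σ` when `v = ⇑σ`). -/
def terms7v (α β : Fin 4 → ℕ) (v : Fin 4 → Fin 4) : List Term := piTerms α β ++ negTerms (piTerms (α ∘ v) β)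

/-- `terms7v α β ⇑σ = terms7 α β σ`. -/
theorem terms7v_coe (α β : Fin 4 → ℕ) (σ : Equiv.Perm (Fin 4)) : terms7v α β σ = terms7 α β σ := rfl

/-- The four indices. -/
def fin4 : List (Fin 4) := [0, 1, 2, 3]

/-- Every index is listed. -/
theorem mem_fin4 (i : Fin 4) : i ∈ fin4 := by fin_cases i <;> simp [fin4]

/-- `v : Fin 4 → Fin 4` is onto (hence a permutation). -/
def isPerm (v : Fin 4 → Fin 4) : Bool := fin4.all fun i => fin4.any fun j => decide (v j = i)

/-- A map passing `isPerm` is a bijection of `Fin 4`. -/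
theorem bijective_of_isPerm {v : Fin 4 → Fin 4} (h : isPerm v = true) : Function.Bijective v := by
  refine Finite.surjective_iff_bijective.1 fun i => ?_
  obtain ⟨j, -, hj⟩ := List.any_eq_true.1 (List.all_eq_true.1 h i (mem_fin4 i))
  exact ⟨j, of_decide_eq_true hj⟩

/-- The term list that certifies a tagged cell: `terms7v α β v` (first tale) or `terms8 A B` (second tale). -/
def CCell.terms (α β A B : Fin 4 → ℕ) : CCell → List Term
  | ⟨some v, _⟩ => terms7v α β v
  | ⟨none, _⟩ => terms8 A B

/-- The permutation tag is a genuine permutation (nothing to check for the second tale). -/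
def permOK : Option (Fin 4 → Fin 4) → Bool
  | some v => isPerm v
  | none => true

/-- **One cell of a level-`lvl` cover passes**: count `c ≥ lvl`, denominators `≤ D`, a genuine permutation, and the
cell checker passes against the cell's term list. -/
def CCell.check (α β A B : Fin 4 → ℕ) (lvl D : ℕ) (C : CCell) : Bool :=
  decide ((lvl : ℤ) ≤ C.cell.c) && decide (C.cell.b0 ≤ D) && decide (C.cell.b1 ≤ D) && permOK C.perm &&
    Cell.check (C.terms α β A B) C.cell

/-- **The cells chain** from the point `a/b` up to at least `V₁/V₂`: each cell starts at or before the point reached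
so far (cross-multiplied comparisons; all denominators are positive where this is used). -/
def chainOK (V₁ V₂ : ℕ) : ℤ → ℕ → List CCell → Bool
  | a, b, [] => decide ((V₁ : ℤ) * b ≤ a * V₂)
  | a, b, C :: cs => decide (C.cell.a0 * (b : ℤ) ≤ a * C.cell.b0) && chainOK V₁ V₂ C.cell.a1 C.cell.b1 cs

/-- **The cover checker**: `0 < U₁` (so `{n/p} ≠ 0`), positive end-point denominators, every cell passes
`CCell.check`, and the cells chain from `U₁/U₂` to `V₁/V₂`. -/
def Cover.check (α β A B : Fin 4 → ℕ) (D : ℕ) (K : Cover) : Bool :=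
  decide (0 < K.U₁) && decide (0 < K.U₂) && decide (0 < K.V₂) && K.cells.all (CCell.check α β A B K.lvl D) &&
    chainOK K.V₁ K.V₂ K.U₁ K.U₂ K.cells

/-! ### Locating `{n/p}` in a cell of the chain -/

/-- **A chained list of cells covers `[a/b, V₁/V₂)` up to end points**: a point `x` with `a/b ≤ x < V₁/V₂` that is
not an end point of any cell lies inside one of the cells. -/
theorem exists_mem_of_chainOK {V₁ V₂ : ℕ} (hV : 0 < V₂) {x : ℚ} (hxv : x < (V₁ : ℚ) / V₂) :
    ∀ (cs : List CCell) (a : ℤ) (b : ℕ), 0 < b → chainOK V₁ V₂ a b cs = true →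
      (∀ C ∈ cs, 0 < C.cell.b0 ∧ 0 < C.cell.b1) →
      (∀ C ∈ cs, x ≠ (C.cell.a0 : ℚ) / C.cell.b0 ∧ x ≠ (C.cell.a1 : ℚ) / C.cell.b1) →
      (a : ℚ) / b ≤ x → ∃ C ∈ cs, (C.cell.a0 : ℚ) / C.cell.b0 < x ∧ x < (C.cell.a1 : ℚ) / C.cell.b1
  | [], a, b, hb, h, _, _, hax => by
    simp only [chainOK, decide_eq_true_eq] at h
    have hb' : (0 : ℚ) < b := by exact_mod_cast hb
    have hV' : (0 : ℚ) < V₂ := by exact_mod_cast hV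
    have hle : (V₁ : ℚ) / V₂ ≤ (a : ℚ) / b := by
      rw [div_le_div_iff₀ hV' hb']; exact_mod_cast h
    exact absurd (hle.trans hax) (not_le.2 hxv)
  | C :: cs, a, b, hb, h, hpos, hne, hax => by
    simp only [chainOK, Bool.and_eq_true, decide_eq_true_eq] at h
    obtain ⟨h1, h2⟩ := h
    obtain ⟨hb0, hb1⟩ := hpos C (by simp)
    have hb' : (0 : ℚ) < b := by exact_mod_cast hb
    have hb0' : (0 : ℚ) < C.cell.b0 := by exact_mod_cast hb0
    have hle : (C.cell.a0 : ℚ) / C.cell.b0 ≤ (a : ℚ) / b := by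
      rw [div_le_div_iff₀ hb0' hb']; exact_mod_cast h1
    have hlo : (C.cell.a0 : ℚ) / C.cell.b0 < x := lt_of_le_of_ne (hle.trans hax) (hne C (by simp)).1.symm
    by_cases hx : x < (C.cell.a1 : ℚ) / C.cell.b1
    · exact ⟨C, by simp, hlo, hx⟩
    · obtain ⟨C', hC', h'⟩ := exists_mem_of_chainOK hV hxv cs C.cell.a1 C.cell.b1 hb1 h2
        (fun C' hm => hpos C' (by simp [hm])) (fun C' hm => hne C' (by simp [hm])) (not_lt.1 hx)
      exact ⟨C', by simp [hC'], h'⟩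

/-- **A prime above the denominators never sits at a cell end point**: `r/p ≠ a/b` for `p` prime, `0 < r < p`,
`0 < b < p`. -/
theorem div_ne_of_prime {p : ℕ} (hp : p.Prime) {r : ℕ} (hr0 : 0 < r) (hrp : r < p) {a : ℤ} {b : ℕ} (hb0 : 0 < b)
    (hbp : b < p) : (r : ℚ) / p ≠ (a : ℚ) / b := by
  intro h
  have hp' : (0 : ℚ) < p := by exact_mod_cast hp.pos
  have hb' : (0 : ℚ) < b := by exact_mod_cast hb0
  rw [div_eq_div_iff hp'.ne' hb'.ne'] at h
  have hz : (((r * b : ℕ) : ℤ) : ℚ) = ((a * p : ℤ) : ℚ) := by push_cast; linarith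
  have hz' : ((r * b : ℕ) : ℤ) = a * p := by exact_mod_cast hz
  have hdvd : (p : ℤ) ∣ ((r * b : ℕ) : ℤ) := ⟨a, by rw [hz', mul_comm]⟩
  have hdvd' : p ∣ r * b := by exact_mod_cast hdvd
  rcases (Nat.Prime.dvd_mul hp).1 hdvd' with h1 | h1
  · exact absurd (Nat.le_of_dvd hr0 h1) (not_le.2 hrp)
  · exact absurd (Nat.le_of_dvd hb0 h1) (not_le.2 hbp)

/-! ### From a checked cell to the level divisibilities -/

section Padic

variable {p : ℕ} [hpp : Fact p.Prime]

/-- `‖D_M‖_p ≤ p⁻¹` for `p ≤ M` (`p ∣ D_M = lcm(1,…,M)`). -/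
theorem padicNorm_lcmUpto_le {M : ℕ} (hM : p ≤ M) : padicNorm p ((Nat.lcmUpto M : ℕ) : ℚ) ≤ (p : ℚ) ^ (-(1 : ℤ)) := by
  have hdvd : ((p ^ 1 : ℕ) : ℤ) ∣ ((Nat.lcmUpto M : ℕ) : ℤ) := by
    rw [pow_one]; exact_mod_cast OddZeta.dvd_lcmUpto hpp.out.one_lt.le hM
  simpa using (padicNorm.dvd_iff_norm_le (p := p)).1 hdvd

/-- **A checked tagged cell containing `{n/p}` certifies the level**: `p^lvl ∣ q(a,b)` and `p^lvl ∣ D_{M₁}D_{M₂}p(a,b)`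
(the integers `formQZ`, `formPZ`).  First-tale cells use Lemma 7 (`DigitBridge.pow_dvd_form{Q,P}Z_of_cell`);
second-tale cells use Lemma 8 at the partner (`DigitBridge.padicNorm_form{Q,P}T_le_of_cell`), the two-tale
coincidence `q = −q̂`, `p = −p̂` and `p ∣ D_{M₁}, D_{M₂}` — hypotheses requested only when the cell IS second-tale. -/
theorem dvd_of_ccell {α β A B : Fin 4 → ℕ} {lvl D : ℕ} {C : CCell} (hC : C.check α β A B lvl D = true)
    {n M₁ M₂ : ℕ} (hadm : Admissible (aOne α n) (bOne β n))
    (hβα : ∀ j i : Fin 4, j ≠ 3 → β j ≤ α i) (hαβ : ∀ i, α i ≤ β 3)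
    (hM : ∀ i j : Fin 4, j ≠ 3 → (aOne α n i - bOne β n j).toNat ≤ M₁)
    (hK₁ : (bOne β n 3 - a2star (aOne α n) - 1).toNat ≤ M₁) (hK₂ : (bOne β n 3 - a2star (aOne α n) - 1).toNat ≤ M₂)
    (hd : dExp (aOne α n) (bOne β n) + 1 ≤ M₂) (hsq : β 3 * n < p ^ 2)
    (h2 : C.perm = none → AdmissibleT (aTwo A n) (bTwo B n) ∧ 2 * bMax (bTwo B n) ≤ (p : ℤ) ^ 2 ∧ p ≤ M₁ ∧ p ≤ M₂ ∧
      formQ (aOne α n) (bOne β n) = -formQT (aTwo A n) (bTwo B n) ∧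
      formP (aOne α n) (bOne β n) = -formPT (aTwo A n) (bTwo B n))
    (m : ℕ) (hx0 : C.cell.a0 * (p : ℤ) < (C.cell.b0 : ℤ) * ((n : ℤ) - m * p))
    (hx1 : (C.cell.b1 : ℤ) * ((n : ℤ) - m * p) < C.cell.a1 * (p : ℤ)) :
    (p : ℤ) ^ lvl ∣ formQZ (aOne α n) (bOne β n) ∧ (p : ℤ) ^ lvl ∣ formPZ (aOne α n) (bOne β n) M₁ M₂ := by
  have hp := hpp.out
  have hp0 : (p : ℚ) ≠ 0 := by exact_mod_cast hp.ne_zero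
  have hp1 : (1 : ℚ) ≤ p := by exact_mod_cast hp.one_lt.le
  have hc : ∀ j : Fin 4, j ≠ 3 → (aOne α n j - bOne β n j).toNat ≤ M₁ := fun j hj => hM j j hj
  obtain ⟨perm, cell⟩ := C
  simp only [CCell.check, Bool.and_eq_true, decide_eq_true_eq] at hC
  obtain ⟨⟨⟨⟨hlc, -⟩, -⟩, hperm⟩, hcheck⟩ := hC
  rcases perm with _ | v
  · -- second tale: Lemma 8 at the partner, transported by the two-tale coincidence
    obtain ⟨hadmT, hsq2, hpM₁, hpM₂, hQ, hP⟩ := h2 rfl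
    have hcheck' : Cell.check (terms8 A B) cell = true := hcheck
    have hq := padicNorm_formQT_le_of_cell hadmT hsq2 hcheck' m hx0 hx1
    have hpt := padicNorm_formPT_le_of_cell hadmT hsq2 hcheck' m hx0 hx1
    have hle : (p : ℚ) ^ (-cell.c) ≤ (p : ℚ) ^ (-(lvl : ℤ)) := zpow_le_zpow_right₀ hp1 (by linarith)
    constructor
    · have hnorm : padicNorm p ((formQZ (aOne α n) (bOne β n) : ℤ) : ℚ) ≤ (p : ℚ) ^ (-(lvl : ℤ)) := by
        rw [← formQ_eq_cast hadm, hQ, padicNorm.neg]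
        exact hq.trans hle
      exact_mod_cast (padicNorm.dvd_iff_norm_le (p := p) (n := lvl)).2 hnorm
    · have hcast := formP_eq_cast hadm hc hK₁ hK₂ hd
      rw [hP] at hcast
      have hnorm : padicNorm p ((formPZ (aOne α n) (bOne β n) M₁ M₂ : ℤ) : ℚ) ≤ (p : ℚ) ^ (-(lvl : ℤ)) := by
        rw [← hcast, padicNorm.mul, padicNorm.mul, padicNorm.neg]
        calc padicNorm p ((Nat.lcmUpto M₁ : ℕ) : ℚ) * padicNorm p ((Nat.lcmUpto M₂ : ℕ) : ℚ)
              * padicNorm p (formPT (aTwo A n) (bTwo B n))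
            ≤ (p : ℚ) ^ (-(1 : ℤ)) * (p : ℚ) ^ (-(1 : ℤ)) * (p : ℚ) ^ (2 - cell.c) :=
              mul_le_mul (mul_le_mul (padicNorm_lcmUpto_le hpM₁) (padicNorm_lcmUpto_le hpM₂) (padicNorm.nonneg _)
                (by positivity)) hpt (padicNorm.nonneg _) (by positivity)
          _ = (p : ℚ) ^ (-cell.c) := by rw [← zpow_add₀ hp0, ← zpow_add₀ hp0]; congr 1; ring
          _ ≤ (p : ℚ) ^ (-(lvl : ℤ)) := hle
      exact_mod_cast (padicNorm.dvd_iff_norm_le (p := p) (n := lvl)).2 hnorm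
  · -- first tale: Lemma 7 with the permutation `v`
    have hv : isPerm v = true := hperm
    let σ : Equiv.Perm (Fin 4) := Equiv.ofBijective v (bijective_of_isPerm hv)
    have hcheck' : Cell.check (terms7 α β σ) cell = true := hcheck
    have hlvl : lvl ≤ cell.c.toNat := by omega
    have hcσ : ∀ j : Fin 4, j ≠ 3 → ((aOne α n ∘ σ) j - bOne β n j).toNat ≤ M₁ := fun j hj => hM (σ j) j hj
    exact ⟨(pow_dvd_pow _ hlvl).trans (pow_dvd_formQZ_of_cell hadm hcheck' hβα hαβ hsq m hx0 hx1),
      (pow_dvd_pow _ hlvl).trans (pow_dvd_formPZ_of_cell hadm hc hcσ hK₁ hK₂ hd hcheck' hβα hαβ hsq m hx0 hx1)⟩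

end Padic

/-! ### Soundness of a checked cover -/

/-- **Soundness of `Cover.check`.**  If the cover of `[U₁/U₂, V₁/V₂)` at level `lvl` passes with denominator bound
`D`, then for every prime `p > D` with `β₃ n < p²` and `{n/p} ∈ [U₁/U₂, V₁/V₂)`:  `p^lvl ∣ q(a,b)` and
`p^lvl ∣ D_{M₁}D_{M₂} p(a,b)` — given the first tale's slope conditions and denominator bounds `M₁, M₂`, and, IF the
cover uses a second-tale cell, the partner's admissibility, `2 b̂₃* ≤ p²`, `p ≤ M₁, M₂` and the two-tale
coincidence `q(a,b) = −q̂(â,b̂)`, `p(a,b) = −p̂(â,b̂)` at this `n` (an INPUT of the consumer). -/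
theorem dvd_of_cover {α β A B : Fin 4 → ℕ} {D : ℕ} {K : Cover} (hK : K.check α β A B D = true)
    {n M₁ M₂ : ℕ} (hadm : Admissible (aOne α n) (bOne β n))
    (hβα : ∀ j i : Fin 4, j ≠ 3 → β j ≤ α i) (hαβ : ∀ i, α i ≤ β 3)
    (hM : ∀ i j : Fin 4, j ≠ 3 → (aOne α n i - bOne β n j).toNat ≤ M₁)
    (hK₁ : (bOne β n 3 - a2star (aOne α n) - 1).toNat ≤ M₁) (hK₂ : (bOne β n 3 - a2star (aOne α n) - 1).toNat ≤ M₂)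
    (hd : dExp (aOne α n) (bOne β n) + 1 ≤ M₂)
    {p : ℕ} (hp : p.Prime) (hDp : D < p) (hsq : β 3 * n < p ^ 2)
    (h2 : (∃ C ∈ K.cells, C.perm = none) → AdmissibleT (aTwo A n) (bTwo B n) ∧ 2 * bMax (bTwo B n) ≤ (p : ℤ) ^ 2 ∧
      p ≤ M₁ ∧ p ≤ M₂ ∧ formQ (aOne α n) (bOne β n) = -formQT (aTwo A n) (bTwo B n) ∧
      formP (aOne α n) (bOne β n) = -formPT (aTwo A n) (bTwo B n))
    (hu : ((K.U₁ : ℝ) / K.U₂) ≤ Int.fract ((n : ℝ) / p)) (hv : Int.fract ((n : ℝ) / p) < (K.V₁ : ℝ) / K.V₂) :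
    (p : ℤ) ^ K.lvl ∣ formQZ (aOne α n) (bOne β n) ∧ (p : ℤ) ^ K.lvl ∣ formPZ (aOne α n) (bOne β n) M₁ M₂ := by
  haveI := Fact.mk hp
  simp only [Cover.check, Bool.and_eq_true, decide_eq_true_eq, List.all_eq_true] at hK
  obtain ⟨⟨⟨⟨hU₁, hU₂⟩, hV₂⟩, hcells⟩, hchain⟩ := hK
  obtain ⟨hur, hvr⟩ := TwoTaleP15.mod_bounds_of_fract hp.pos hU₂ hV₂ hu hv
  have hdm : n % p + p * (n / p) = n := Nat.mod_add_div n p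
  have hrp : n % p < p := Nat.mod_lt _ hp.pos
  generalize hr : n % p = r at hur hvr hdm hrp
  generalize hq : n / p = m at hdm
  have hp' : (0 : ℚ) < p := by exact_mod_cast hp.pos
  have hr0 : 0 < r := by
    rcases Nat.eq_zero_or_pos r with h0 | h0
    · rw [h0, mul_zero] at hur
      exact absurd hur (not_le.2 (Nat.mul_pos hU₁ hp.pos))
    · exact h0
  have hax : ((K.U₁ : ℤ) : ℚ) / (K.U₂ : ℕ) ≤ (r : ℚ) / p := by
    rw [div_le_div_iff₀ (by exact_mod_cast hU₂) hp']
    have : ((K.U₁ * p : ℕ) : ℚ) ≤ ((K.U₂ * r : ℕ) : ℚ) := by exact_mod_cast hur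
    push_cast at this ⊢; linarith
  have hxv : (r : ℚ) / p < (K.V₁ : ℚ) / K.V₂ := by
    rw [div_lt_div_iff₀ hp' (by exact_mod_cast hV₂)]
    have : ((K.V₂ * r : ℕ) : ℚ) < ((K.V₁ * p : ℕ) : ℚ) := by exact_mod_cast hvr
    push_cast at this ⊢; linarith
  have hpos : ∀ C ∈ K.cells, 0 < C.cell.b0 ∧ 0 < C.cell.b1 := fun C hC => by
    have h := hcells C hC
    simp only [CCell.check, Bool.and_eq_true, decide_eq_true_eq] at h
    exact denoms_pos_of_check h.2
  have hne : ∀ C ∈ K.cells, (r : ℚ) / p ≠ (C.cell.a0 : ℚ) / C.cell.b0 ∧ (r : ℚ) / p ≠ (C.cell.a1 : ℚ) / C.cell.b1 :=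
    fun C hC => by
    have h := hcells C hC
    simp only [CCell.check, Bool.and_eq_true, decide_eq_true_eq] at h
    obtain ⟨⟨⟨⟨-, hb0D⟩, hb1D⟩, -⟩, hch⟩ := h
    obtain ⟨hb0, hb1⟩ := denoms_pos_of_check hch
    exact ⟨div_ne_of_prime hp hr0 hrp hb0 (by omega), div_ne_of_prime hp hr0 hrp hb1 (by omega)⟩
  obtain ⟨C, hCmem, hlo, hhi⟩ := exists_mem_of_chainOK hV₂ hxv K.cells K.U₁ K.U₂ hU₂ hchain hpos hne hax
  obtain ⟨hb0, hb1⟩ := hpos C hCmem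
  have hm : ((n : ℤ) - m * p) = (r : ℤ) := by
    have h' : ((r + p * m : ℕ) : ℤ) = n := by exact_mod_cast hdm
    push_cast at h'
    linear_combination (-1 : ℤ) * h'
  have hx0 : C.cell.a0 * (p : ℤ) < (C.cell.b0 : ℤ) * ((n : ℤ) - m * p) := by
    rw [hm]
    have h : (C.cell.a0 : ℚ) * p < (r : ℚ) * C.cell.b0 := by
      have := hlo; rwa [div_lt_div_iff₀ (by exact_mod_cast hb0) hp'] at this
    have h' : ((C.cell.a0 * p : ℤ) : ℚ) < (((r : ℤ) * C.cell.b0 : ℤ) : ℚ) := by push_cast; linarith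
    have h'' := Int.cast_lt.mp h'
    linarith
  have hx1 : (C.cell.b1 : ℤ) * ((n : ℤ) - m * p) < C.cell.a1 * (p : ℤ) := by
    rw [hm]
    have h : (r : ℚ) * C.cell.b1 < (C.cell.a1 : ℚ) * p := by
      have := hhi; rwa [div_lt_div_iff₀ hp' (by exact_mod_cast hb1)] at this
    have h' : ((((r : ℤ) * C.cell.b1 : ℤ)) : ℚ) < ((C.cell.a1 * p : ℤ) : ℚ) := by push_cast; linarith
    have h'' := Int.cast_lt.mp h'
    linarith
  exact dvd_of_ccell (hcells C hCmem) hadm hβα hαβ hM hK₁ hK₂ hd hsq (fun h => h2 ⟨C, hCmem, h⟩) m hx0 hx1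

/-- **First-tale-only covers are unconditional**: if every cell of the cover is a first-tale cell, no partner data
and no two-tale coincidence is needed. -/
theorem dvd_of_cover₁ {α β A B : Fin 4 → ℕ} {D : ℕ} {K : Cover} (hK : K.check α β A B D = true)
    (h1 : K.cells.all (fun C => C.perm.isSome) = true)
    {n M₁ M₂ : ℕ} (hadm : Admissible (aOne α n) (bOne β n))
    (hβα : ∀ j i : Fin 4, j ≠ 3 → β j ≤ α i) (hαβ : ∀ i, α i ≤ β 3)
    (hM : ∀ i j : Fin 4, j ≠ 3 → (aOne α n i - bOne β n j).toNat ≤ M₁)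
    (hK₁ : (bOne β n 3 - a2star (aOne α n) - 1).toNat ≤ M₁) (hK₂ : (bOne β n 3 - a2star (aOne α n) - 1).toNat ≤ M₂)
    (hd : dExp (aOne α n) (bOne β n) + 1 ≤ M₂)
    {p : ℕ} (hp : p.Prime) (hDp : D < p) (hsq : β 3 * n < p ^ 2)
    (hu : ((K.U₁ : ℝ) / K.U₂) ≤ Int.fract ((n : ℝ) / p)) (hv : Int.fract ((n : ℝ) / p) < (K.V₁ : ℝ) / K.V₂) :
    (p : ℤ) ^ K.lvl ∣ formQZ (aOne α n) (bOne β n) ∧ (p : ℤ) ^ K.lvl ∣ formPZ (aOne α n) (bOne β n) M₁ M₂ :=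
  dvd_of_cover hK hadm hβα hαβ hM hK₁ hK₂ hd hp hDp hsq (fun ⟨C, hC, hnone⟩ => by
    have h := List.all_eq_true.1 h1 C hC
    simp [hnone] at h) hu hv

end Denom.DigitCover

end Summit.KontsevichZagierPeriods.Zeta5Search
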